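import Mathlib
import HarnessLib
import Literature.Computability.AlgebraicComplexity.GroupTheoreticMatMul
import Summits.MatrixMultiplication.OmegaCensus.STPPDisjointPacking

/-!
# FarEdgeDescent — Kernel LII (lens-2, gen 69): DOUBLE PACKING at the skinny format

Def-free, sorry-free, ROUTE-INDEPENDENT support (imports no `Theses` file) for the special crux
`FiniteSaturation` (stmt-MatrixMultiplication-23739) of `Theses/FarEdgeDescent.lean`; the cut
`closes (h₁ : FiniteSaturation) (h₂ : AnchoredLogConvexity)` is UNCHANGED and nothing here enters it.
Companion of Kernel LI (`Theorems/FarEdgeDescentSTPPSaturation`: `STPPSat_k ⟹ h₁`, one-term packing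
`s·a^{k+1} ≤ |H|`, many-pieces screen `a^{1-(k+1)ε} ≤ s`); content = critic ruling lens-2 g69
(decomp-mm STATUS l.3375 (i)) = census offer I-g63b ((L) of I278).
PROVENANCE / DEDUP (critic decomp-mm STATUS l.3384): the two-term packing lemma (L) is a TREE theorem —
`Summit.MatrixMultiplication.OmegaCensus.stpp_sum_erase_card_mul_add_sum_card_mul_le` (census filter N5,
pair `(BC, AC)`, over `IsSTPP`) and `AutomaticDesignBelowFourFifths.sum_erase_card_mul_card_add_sum_le`
(route AutomaticSTPPDesigns, crux stmt-7357, pair `(AB, AC)`, over `AddSimultaneousTPP`; module unbuilt on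
the farm at the time of writing) — and §1 CITES the former, transported to the HEAVY pair `(AB, BC)` by the
role rotation `(A, B, C) ↦ (C, A, B)`; this file's own content is §2 only.
* §1 `sum_erase_card_mul_card_add_sum_le_of_isSTPP`: `∑_{i≠j} |Aᵢ||Bᵢ| + ∑ᵢ |Bᵢ||Cᵢ| ≤ |H|` (citation).
* §2 format `(a, a^k, a)`: ★ `two_mul_sub_one_mul_pow_le_card_of_isSTPP` **`(2s−1)·a^{k+1} ≤ |H|`**
  (packing efficiency `s·a^{k+1}/|H| ≤ s/(2s−1)`: never near-perfect), and under the Kernel-LI budget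
  `|H| ≤ s·a^{(k+1)(1+ε)}`: ★ `two_sub_inv_le_rpow_of_stpp_budget` **`2 − 1/s ≤ a^{(k+1)ε}`**.
  REMARK (not typed here, to stay route-independent): with Kernel LI's screen (`s ≥ 2` once
  `(k+1)ε < 1`) this reads `a^{(k+1)ε} ≥ 3/2`, i.e. every tolerance-`ε` witness has piece size
  `a ≥ (3/2)^{1/((k+1)ε)}` and `s ≥ a^{1-(k+1)ε}` pieces — both exponential in `1/ε`
  (`k = 2, ε = 0.02`: `a ≥ 861`, `s ≥ 574`): the `ε → 0` corner lives in no finite box.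
  Asymptotically silent (`STPPSat_k` untouched); nothing here proves `ω = 2` or the crux; no definitions.
[cite: BlasiakChurchCohnGrochowNaslundSawinUmans2017, Def. 2.2, §2]
[cite: CohnKleinbergSzegedyUmans2005, Def. 5.1, §5] [cite: CohnUmans2003, Lemma 3.1]
-/

-- single-conjunct summit: the mandated namespace repeats `MatrixMultiplication`.
set_option linter.dupNamespace false

namespace Summit.MatrixMultiplication.MatrixMultiplication.Theorems.FarEdgeDescentSTPPDoublePacking

open Finset Literature.Computability.AlgebraicComplexity

/-- ★ **Double packing lemma (L)** at the HEAVY pair `(AB, BC)`: for an `IsSTPP` family in a finite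
abelian group with all `Aᵢ, Cᵢ` nonempty and any `j`, `∑_{i ≠ j} |Aᵢ||Bᵢ| + ∑ᵢ |Bᵢ||Cᵢ| ≤ |H|`.
This is the TREE theorem `Summit.MatrixMultiplication.OmegaCensus.stpp_sum_erase_card_mul_add_sum_card_mul_le`
(census filter N5, pair `(BC, AC)`; equivalently `AutomaticDesignBelowFourFifths.sum_erase_card_mul_card_add_sum_le`,
pair `(AB, AC)`) applied to the twice-rotated family `(C, A, B)` (rotation = the tree's `AutomaticPackingThesis.isSTPP_rotate`,
inlined as a `have`) — a citation, not a re-proof.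
[cite: BlasiakChurchCohnGrochowNaslundSawinUmans2017, §2]
[cite: CohnKleinbergSzegedyUmans2005, Def. 5.1] -/
theorem sum_erase_card_mul_card_add_sum_le_of_isSTPP {H : Type*} [AddCommGroup H] [Fintype H]
    [DecidableEq H] {N : ℕ} {A B C : Fin N → Finset H} (hS : IsSTPP A B C)
    (hA : ∀ i, (A i).Nonempty) (hC : ∀ i, (C i).Nonempty) (j : Fin N) :
    ∑ i ∈ univ.erase j, (A i).card * (B i).card + ∑ i, (B i).card * (C i).card ≤
      Fintype.card H := by
  -- role rotation `(A, B, C) ↦ (B, C, A)` (the tree's `AutomaticPackingThesis.isSTPP_rotate` /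
  -- `STPP222CubeNeg.isSTPP_rotate`; inlined, their modules being outside this file's import closure)
  have hrot : ∀ {A' B' C' : Fin N → Finset H}, IsSTPP A' B' C' → IsSTPP B' C' A' := by
    intro A' B' C' h' i j k s hs s' hs' t ht t' ht' u hu u' hu' h0
    have h0' : (u' - u) + (s' - s) + (t' - t) = 0 := by rw [← h0]; abel
    obtain ⟨hki, hij, e1, e2, e3⟩ := h' k i j u hu u' hu' s hs s' hs' t ht t' ht' h0'
    exact ⟨hij, (hki.trans hij).symm, e2, e3, e1⟩
  have h := Summit.MatrixMultiplication.OmegaCensus.stpp_sum_erase_card_mul_add_sum_card_mul_le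
    (hrot (hrot hS)) hC hA j
  have e : ∑ i, (B i).card * (C i).card = ∑ i, (C i).card * (B i).card :=
    sum_congr rfl fun i _ => Nat.mul_comm _ _
  rw [e]; exact h

/-- ★ **`(2s − 1)·a^{k+1} ≤ |H|`** for an abelian STPP family of `s` triples of the format
`(a, a^k, a)`, `a ≥ 1`: (L) at the two heavy pairs `|Aᵢ||Bᵢ| = |Bᵢ||Cᵢ| = a^{k+1}` (Kernel LI:
one-term `s·a^{k+1} ≤ |H|`). [cite: BlasiakChurchCohnGrochowNaslundSawinUmans2017, §2] -/
theorem two_mul_sub_one_mul_pow_le_card_of_isSTPP {H : Type} [AddCommGroup H] [Fintype H]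
    [DecidableEq H] {k s a : ℕ} {A B C : Fin s → Finset H} (hS : IsSTPP A B C) (ha : 1 ≤ a)
    (hcard : ∀ i, (A i).card = a ∧ (B i).card = a ^ k ∧ (C i).card = a) :
    (2 * s - 1) * a ^ (k + 1) ≤ Fintype.card H := by
  rcases Nat.eq_zero_or_pos s with rfl | hs
  · simp
  have h := sum_erase_card_mul_card_add_sum_le_of_isSTPP hS
    (fun i => card_pos.1 (by rw [(hcard i).1]; omega))
    (fun i => card_pos.1 (by rw [(hcard i).2.2]; omega)) ⟨0, hs⟩
  have hAB : ∀ i, (A i).card * (B i).card = a ^ (k + 1) := fun i => by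
    rw [(hcard i).1, (hcard i).2.1]; ring
  have hBC : ∀ i, (B i).card * (C i).card = a ^ (k + 1) := fun i => by
    rw [(hcard i).2.1, (hcard i).2.2]; ring
  simp_rw [hAB, hBC, sum_const, card_erase_of_mem (mem_univ _), card_univ, Fintype.card_fin,
    smul_eq_mul] at h
  calc (2 * s - 1) * a ^ (k + 1) = (s - 1) * a ^ (k + 1) + s * a ^ (k + 1) := by
        rw [← Nat.add_mul]; congr 1; omega
    _ ≤ Fintype.card H := h

/-- ★ **`2 − 1/s ≤ a^{(k+1)ε}` under the Kernel-LI budget `|H| ≤ s·a^{(k+1)(1+ε)}`** (`s ≥ 1`,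
`a ≥ 2`): the packing efficiency `≥ a^{-(k+1)ε}` demanded by the budget meets the ceiling `s/(2s−1)`
forced by (L). [cite: BlasiakChurchCohnGrochowNaslundSawinUmans2017, §2] -/
theorem two_sub_inv_le_rpow_of_stpp_budget {H : Type} [AddCommGroup H] [Fintype H]
    [DecidableEq H] {k s a : ℕ} {A B C : Fin s → Finset H} {ε : ℝ} (hS : IsSTPP A B C)
    (hs : 1 ≤ s) (ha : 2 ≤ a) (hcard : ∀ i, (A i).card = a ∧ (B i).card = a ^ k ∧ (C i).card = a)
    (hH : (Fintype.card H : ℝ) ≤ s * (a : ℝ) ^ (((k : ℝ) + 1) * (1 + ε))) :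
    2 - 1 / (s : ℝ) ≤ (a : ℝ) ^ (((k : ℝ) + 1) * ε) := by
  have hs0 : (0 : ℝ) < s := by exact_mod_cast hs
  have ha0 : (0 : ℝ) < a := by exact_mod_cast (by omega : 0 < a)
  set P : ℝ := (a : ℝ) ^ ((k : ℝ) + 1) with hP
  have hPn : ((a ^ (k + 1) : ℕ) : ℝ) = P := by
    rw [hP, show (k : ℝ) + 1 = ((k + 1 : ℕ) : ℝ) by push_cast; ring, Real.rpow_natCast]
    push_cast; rfl
  -- (L) cast to `ℝ`, then the budget split as `s · a^{(k+1)ε} · P`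
  have h1 : (2 * (s : ℝ) - 1) * P ≤ Fintype.card H := by
    have h' : (((2 * s - 1) * a ^ (k + 1) : ℕ) : ℝ) ≤ Fintype.card H := by
      exact_mod_cast two_mul_sub_one_mul_pow_le_card_of_isSTPP hS (by omega) hcard
    rw [Nat.cast_mul, hPn, Nat.cast_sub (by omega)] at h'
    push_cast at h'
    exact h'
  have e : (a : ℝ) ^ (((k : ℝ) + 1) * (1 + ε)) = (a : ℝ) ^ (((k : ℝ) + 1) * ε) * P := by
    rw [hP, ← Real.rpow_add ha0]; ring_nf
  rw [e, ← mul_assoc] at hH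
  have h3 : 2 * (s : ℝ) - 1 ≤ (s : ℝ) * (a : ℝ) ^ (((k : ℝ) + 1) * ε) :=
    le_of_mul_le_mul_right (h1.trans hH) (Real.rpow_pos_of_pos ha0 _)
  rw [show 2 - 1 / (s : ℝ) = (2 * s - 1) / s by field_simp, div_le_iff₀ hs0]
  linarith

end Summit.MatrixMultiplication.MatrixMultiplication.Theorems.FarEdgeDescentSTPPDoublePacking
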